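import Summits.QuantumFields.GaugeBoot.DiagonalRPTorusNegative
import Literature.MathematicalPhysics.QuantumFieldTheory.LatticeGaugeStaticPotentialProofs
import HarnessLib

/-!
# Plaquettes of `(ℤ/L)^d` under the diagonal swap (gauge-boot, task L3 sequel, 1/7)

HONEST FRAMING (cell `pub-gaugeboot`, page 1 of every file): the venture produces certified bounds
on lattice expectations at stated coupling, gauge group, dimension and torus size; NOT a mass gap,
NOT a continuum limit, NOT a string tension; NOT Yang–Mills-summit-bearing (barriers
`FixedCouplingUltralocality`, `PerturbativeInvisibility`). This module is bookkeeping for a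
structural NEGATIVE result (`DiagonalRPTorusInnerHalfNegativeHighDim`: inner-half diagonal RP
fails on every even torus `(ℤ/L)^d`, `d ≥ 4`, `L ≥ 4`, at small coupling); it discharges nothing
by itself.

## Content (torus `(ℤ/L)^d`, any `d`, any `L`, mirror `y_i = y_j`)

Plaquette bookkeeping in GENERAL dimension, in the tree's torus vocabulary (`Site`, `Edge`,
`Plaquette`, `plaquetteHolonomy`, `WilsonRP.plaqRe`, `configDiagSwap` of `DiagonalRPTorusNegative`):

* `lay i j y = y_i - y_j` (the layer coordinate of the mirror), `vert q` / `link q` (the four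
  vertices / links of a plaquette as `Fin 4`-indexed families), `HasLink q e`;
  `plaqRe_congr` / `plaqRe_update_of_not_hasLink` (a plaquette value reads only its links);
* `plaqSwap i j` — the action of the swap `θ = (i j)` on plaquettes (`(x; m, n) ↦ (θx; {σm, σn})`
  re-ordered), an involution (`plaqSwap_plaqSwap`), its vertices (`exists_vert_plaqSwap`), and
  **`plaqRe_configDiagSwap`**: `Re tr ρ((ΘU)_q) = Re tr ρ(U_{θq})` for EVERY plaquette (the one
  type `(i, j)` whose orientation `θ` reverses is absorbed by `Re tr ρ(g⁻¹) = Re tr ρ(g)`);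
* continuity of plaquette values and of `Θ`.

Elementary bookkeeping; no named fact.
-/

open MeasureTheory Complex Finset Function

namespace Summit.QuantumFields.GaugeBoot

open Literature.MathematicalPhysics.QuantumFieldTheory

noncomputable section

namespace DiagRPTube

/-! ## Layers, vertices, the swap on plaquettes -/

section Geometry

variable {d L : ℕ}

/-- The layer coordinate `δ(y) = y_i - y_j ∈ ℤ/L` of the mirror `y_i = y_j`. -/
def lay (i j : Fin d) (y : Site d L) : ZMod L := y i - y j

/-- The four vertices `x`, `x + e_m`, `x + e_n`, `x + e_m + e_n` of the plaquette `(x; m, n)`. -/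
def vert (q : Plaquette d L) : Fin 4 → Site d L
  | 0 => q.1
  | 1 => q.1.shift q.2.1.1
  | 2 => q.1.shift q.2.1.2
  | 3 => (q.1.shift q.2.1.1).shift q.2.1.2

/-- The four links `(x,m)`, `(x+e_m,n)`, `(x+e_n,m)`, `(x,n)` of the plaquette `(x; m, n)` (the
links entering `plaquetteHolonomy U x m n`). -/
def link (q : Plaquette d L) : Fin 4 → Edge d L
  | 0 => (q.1, q.2.1.1)
  | 1 => (q.1.shift q.2.1.1, q.2.1.2)
  | 2 => (q.1.shift q.2.1.2, q.2.1.1)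
  | 3 => (q.1, q.2.1.2)

/-- `q` contains the link `e`. [shape] A parametric definition of a proposition — NOT a fact. [folklore] -/
def HasLink (q : Plaquette d L) (e : Edge d L) : Prop := ∃ a : Fin 4, link q a = e

/-- `HasLink` is decidable. -/
instance (q : Plaquette d L) (e : Edge d L) : Decidable (HasLink q e) := by
  unfold HasLink; infer_instance

/-- The plaquette value reads only its four links. -/
theorem plaqRe_congr {N : ℕ} {G : Type*} [Group G] (ρ : G →* Matrix (Fin N) (Fin N) ℂ)
    (q : Plaquette d L) {U V : GaugeConfig d L G} (h : ∀ a : Fin 4, U (link q a) = V (link q a)) :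
    WilsonRP.plaqRe ρ U q = WilsonRP.plaqRe ρ V q := by
  unfold WilsonRP.plaqRe plaquetteHolonomy
  rw [show (q.1, q.2.1.1) = link q 0 from rfl, show (q.1.shift q.2.1.1, q.2.1.2) = link q 1 from rfl,
    show (q.1.shift q.2.1.2, q.2.1.1) = link q 2 from rfl, show (q.1, q.2.1.2) = link q 3 from rfl,
    h 0, h 1, h 2, h 3]

/-- A plaquette value does not read a link off the plaquette. -/
theorem plaqRe_update_of_not_hasLink {N : ℕ} {G : Type*} [Group G]
    (ρ : G →* Matrix (Fin N) (Fin N) ℂ) (q : Plaquette d L) {e : Edge d L} (he : ¬ HasLink q e)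
    (U : GaugeConfig d L G) (s : G) :
    WilsonRP.plaqRe ρ (update U e s) q = WilsonRP.plaqRe ρ U q :=
  plaqRe_congr ρ q fun a => update_of_ne (fun h => he ⟨a, h⟩) _ _

/-- The endpoints of the four links are vertices: start points. -/
theorem link_fst_mem_vert (q : Plaquette d L) (a : Fin 4) : ∃ b : Fin 4, (link q a).1 = vert q b := by
  fin_cases a
  · exact ⟨0, rfl⟩
  · exact ⟨1, rfl⟩
  · exact ⟨2, rfl⟩
  · exact ⟨0, rfl⟩

/-- The endpoints of the four links are vertices: end points. -/
theorem link_shift_mem_vert (q : Plaquette d L) (a : Fin 4) :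
    ∃ b : Fin 4, (link q a).1.shift (link q a).2 = vert q b := by
  fin_cases a
  · exact ⟨1, rfl⟩
  · exact ⟨3, rfl⟩
  · exact ⟨3, by simp only [link, vert]; exact WilsonRP.shift_comm _ _ _⟩
  · exact ⟨2, rfl⟩

/-- The ordered pair of two distinct indices. -/
def orderPair (a b : Fin d) (hab : a ≠ b) : {p : Fin d × Fin d // p.1 < p.2} :=
  if h : a < b then ⟨(a, b), h⟩ else ⟨(b, a), lt_of_le_of_ne (not_lt.1 h) (Ne.symm hab)⟩

/-- The action of the coordinate swap `θ = (i j)` on plaquettes: `(x; m, n) ↦ (θx; {σm, σn})`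
with the pair re-ordered, `σ = (i j)`. -/
def plaqSwap (i j : Fin d) (q : Plaquette d L) : Plaquette d L :=
  (siteDiagSwap i j q.1, orderPair (Equiv.swap i j q.2.1.1) (Equiv.swap i j q.2.1.2)
    fun h => (ne_of_lt q.2.2) ((Equiv.swap i j).injective h))

/-- The ordered pair is the pair or its swap. -/
theorem orderPair_val_or (a b : Fin d) (hab : a ≠ b) :
    (orderPair a b hab).1 = (a, b) ∨ (orderPair a b hab).1 = (b, a) := by
  unfold orderPair
  split_ifs <;> simp

/-- The base point of `θq` is `θ` of the base point. -/
@[simp] theorem plaqSwap_fst (i j : Fin d) (q : Plaquette d L) :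
    (plaqSwap i j q).1 = siteDiagSwap i j q.1 := rfl

/-- The directions of `θq` are `σ` of the directions of `q`, in one of the two orders. -/
theorem plaqSwap_dirs (i j : Fin d) (q : Plaquette d L) :
    ((plaqSwap i j q).2.1.1 = Equiv.swap i j q.2.1.1 ∧
        (plaqSwap i j q).2.1.2 = Equiv.swap i j q.2.1.2) ∨
      ((plaqSwap i j q).2.1.1 = Equiv.swap i j q.2.1.2 ∧
        (plaqSwap i j q).2.1.2 = Equiv.swap i j q.2.1.1) := by
  unfold plaqSwap
  rcases orderPair_val_or (Equiv.swap i j q.2.1.1) (Equiv.swap i j q.2.1.2)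
      (fun h => (ne_of_lt q.2.2) ((Equiv.swap i j).injective h)) with h | h
  · exact Or.inl ⟨by simp only [h], by simp only [h]⟩
  · exact Or.inr ⟨by simp only [h], by simp only [h]⟩

/-- `plaqSwap` is an involution. -/
theorem plaqSwap_plaqSwap (i j : Fin d) (q : Plaquette d L) : plaqSwap i j (plaqSwap i j q) = q := by
  have hσ : ∀ a : Fin d, Equiv.swap i j (Equiv.swap i j a) = a := fun a => Equiv.swap_apply_self _ _ _
  obtain ⟨x, ⟨⟨m, n⟩, hmn⟩⟩ := q
  refine Prod.ext (by simp [siteDiagSwap_siteDiagSwap]) (Subtype.ext ?_)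
  rcases plaqSwap_dirs i j (plaqSwap i j ((x, ⟨(m, n), hmn⟩) : Plaquette d L)) with ⟨h1, h2⟩ | ⟨h1, h2⟩
  · rcases plaqSwap_dirs i j ((x, ⟨(m, n), hmn⟩) : Plaquette d L) with ⟨h3, h4⟩ | ⟨h3, h4⟩
    · exact Prod.ext (by rw [h1, h3, hσ]) (by rw [h2, h4, hσ])
    · exfalso
      have hlt := (plaqSwap i j (plaqSwap i j ((x, ⟨(m, n), hmn⟩) : Plaquette d L))).2.2
      rw [h1, h2, h3, h4, hσ, hσ] at hlt
      exact lt_asymm hmn hlt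
  · rcases plaqSwap_dirs i j ((x, ⟨(m, n), hmn⟩) : Plaquette d L) with ⟨h3, h4⟩ | ⟨h3, h4⟩
    · exfalso
      have hlt := (plaqSwap i j (plaqSwap i j ((x, ⟨(m, n), hmn⟩) : Plaquette d L))).2.2
      rw [h1, h2, h3, h4, hσ, hσ] at hlt
      exact lt_asymm hmn hlt
    · exact Prod.ext (by rw [h1, h4, hσ]) (by rw [h2, h3, hσ])

/-- `plaqSwap` as a permutation of the plaquettes. -/
def plaqSwapEquiv (i j : Fin d) : Equiv.Perm (Plaquette d L) where
  toFun := plaqSwap i j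
  invFun := plaqSwap i j
  left_inv := plaqSwap_plaqSwap i j
  right_inv := plaqSwap_plaqSwap i j

/-- The layer of a swapped site is the negative of the layer. -/
theorem lay_siteDiagSwap (i j : Fin d) (y : Site d L) :
    lay i j (siteDiagSwap i j y) = -lay i j y := by
  simp [lay, siteDiagSwap, Equiv.swap_apply_left, Equiv.swap_apply_right]

/-- The vertex set of `θq` is `θ` of the vertex set of `q`. -/
theorem exists_vert_plaqSwap (i j : Fin d) (q : Plaquette d L) (a : Fin 4) :
    ∃ b : Fin 4, vert (plaqSwap i j q) a = siteDiagSwap i j (vert q b) := by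
  have hs := siteDiagSwap_shift (L := L) i j
  rcases plaqSwap_dirs i j q with ⟨h1, h2⟩ | ⟨h1, h2⟩
  · fin_cases a
    · exact ⟨0, rfl⟩
    · exact ⟨1, by simp only [vert, h1, plaqSwap_fst]; exact (hs q.1 _).symm⟩
    · exact ⟨2, by simp only [vert, h2, plaqSwap_fst]; exact (hs q.1 _).symm⟩
    · exact ⟨3, by simp only [vert, h1, h2, plaqSwap_fst]; rw [hs, hs]⟩
  · fin_cases a
    · exact ⟨0, rfl⟩
    · exact ⟨2, by simp only [vert, h1, plaqSwap_fst]; exact (hs q.1 _).symm⟩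
    · exact ⟨1, by simp only [vert, h2, plaqSwap_fst]; exact (hs q.1 _).symm⟩
    · exact ⟨3, by
        simp only [vert, h1, h2, plaqSwap_fst]
        rw [hs, hs, WilsonRP.shift_comm]⟩

end Geometry

/-! ## The swap on plaquette values -/

section SwapValue

variable {d L N : ℕ} {G : Type*} [Group G] [TopologicalSpace G] [IsTopologicalGroup G]
  [CompactSpace G] (ρ : G →* Matrix (Fin N) (Fin N) ℂ)

omit [TopologicalSpace G] [IsTopologicalGroup G] [CompactSpace G] in
/-- `(ΘU)_{(x;m,n)} = U` around `(θx; σm, σn)` in this order. -/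
theorem plaquetteHolonomy_configDiagSwap (i j : Fin d) (U : GaugeConfig d L G) (x : Site d L)
    (m n : Fin d) : plaquetteHolonomy (configDiagSwap i j U) x m n =
      plaquetteHolonomy U (siteDiagSwap i j x) (Equiv.swap i j m) (Equiv.swap i j n) := by
  unfold plaquetteHolonomy configDiagSwap edgeDiagSwap
  simp only [siteDiagSwap_shift]

/-- **`Re tr ρ((ΘU)_q) = Re tr ρ(U_{θq})`** for every plaquette `q` of `(ℤ/L)^d`. -/
theorem plaqRe_configDiagSwap (hρ : Continuous ρ) (i j : Fin d) (U : GaugeConfig d L G)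
    (q : Plaquette d L) :
    WilsonRP.plaqRe ρ (configDiagSwap i j U) q = WilsonRP.plaqRe ρ U (plaqSwap i j q) := by
  unfold WilsonRP.plaqRe
  rw [plaquetteHolonomy_configDiagSwap]
  rcases plaqSwap_dirs i j q with ⟨h1, h2⟩ | ⟨h1, h2⟩
  · rw [h1, h2, plaqSwap_fst]
  · rw [h1, h2, plaqSwap_fst, plaquetteHolonomy_swap U _ (Equiv.swap i j q.2.1.2) (Equiv.swap i j q.2.1.1),
      Literature.RepresentationTheory.CompactGroups.CompactGroup.re_trace_map_inv ρ hρ]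

omit [IsTopologicalGroup G] [CompactSpace G] in
/-- A plaquette value is continuous in the configuration. -/
theorem continuous_plaqRe [ContinuousMul G] [ContinuousInv G] (hρ : Continuous ρ)
    (q : Plaquette d L) : Continuous fun U : GaugeConfig d L G => WilsonRP.plaqRe ρ U q := by
  have h1 := continuous_apply (A := fun _ : Edge d L => G) (q.1, q.2.1.1)
  have h2 := continuous_apply (A := fun _ : Edge d L => G) (q.1.shift q.2.1.1, q.2.1.2)
  have h3 := continuous_apply (A := fun _ : Edge d L => G) (q.1.shift q.2.1.2, q.2.1.1)
  have h4 := continuous_apply (A := fun _ : Edge d L => G) (q.1, q.2.1.2)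
  unfold WilsonRP.plaqRe plaquetteHolonomy
  exact Complex.continuous_re.comp (hρ.matrix_trace.comp (((h1.mul h2).mul h3.inv).mul h4.inv))

omit [Group G] [IsTopologicalGroup G] [CompactSpace G] in
/-- `Θ` is continuous on configurations. -/
theorem continuous_configDiagSwap (i j : Fin d) :
    Continuous (configDiagSwap (G := G) (d := d) (L := L) i j) :=
  continuous_pi fun _ => continuous_apply _

end SwapValue

end DiagRPTube

end

end Summit.QuantumFields.GaugeBoot
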